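import Summits.FinalStateConjecture.FinalStateConjecture.Theses.PhaseMixingCapture
import Summits.FinalStateConjecture.FinalStateConjecture.Theorems.NearExtremalKappaCapture.Negative.ExponentMonotonicity
import Literature.Geometry.Lorentzian.Sweep2

/-!
# Skeleton line `polynomial-closure` for crux `NearExtremalKappaCapture` (stmt-FinalStateConjecture-10606)

Route `PhaseMixingCapture`, crux rank 2 `NearExtremalKappaCapture` =
`∀ [Kerr.Facts] [Kerr.SliceFacts], ∃ (s δ k γ p a₁), a₁ < 1 ∧ CaptureWith s δ k γ p a₁`
(`Negative.ExponentMonotonicity.near_iff`, `Iff.rfl`): κ-explicit nonlinear capture of the spins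
`a₁M ≤ |a| < M` — basin `c(M)·χ^γ` in the weighted Sobolev distance to the Kerr datum on the
Kerr–Schild slice `{t* = 0, r > M}`, far-complete `𝓘⁺`, `C^k` convergence to a SUB-extremal Kerr
`g_{M',a'}`, modulus `|M' − M| + |a' − a| ≤ C(M)·χ^{−p}·√dist`, `χ = 1 − (a/M)² ≍ (κM)²`.
Planner skeleton, crux-plan round 1 (planner-cruxplan-stmt-FinalStateConjecture-10606-polynomial-closure-0,
2026-08-16); idea card `Ideas/polynomial-closure.md` (ideator 1; triage r1: 3 × pass, merge group B =
{polynomial-closure ≈ polynomial-in-polynomial-out ≈ nash-moser-inherits-kappa-powers}).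

## The line: polynomial in ⇒ polynomial out

The crux tolerates ANY fixed powers of `χ` (its admissible exponent vectors form an up-set,
`captureWith_mono`, and only super-polynomial degeneration refutes it, `not_near_iff`). The card's
audit principle says where a super-polynomial loss could enter a nonlinear Kerr-stability proof and
closes every door but one: (α) CLOSING IS POLYNOMIAL — a continuity/bootstrap or Nash–Moser scheme
closes for data below a threshold that is a MONOMIAL in its linear constant `Λ` and its background
constant `B` (explicit instance PROVED by the ideator: `SketchIdeator1.firstLemma_polynomialBasin`,
`ε ≤ 1/(16C²K)`; Newton–Kantorovich form PROVED by ideator 2, `SketchIdeator2.firstLemma_newtonKantorovich`;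
Hörmander 1976 §2 / Alinhac–Gérard Ch. III for Nash–Moser with tracked constants; Hintz
arXiv:2606.28253 Thm 1.1 + Rem 1.4 is the qualitative theorem at every FIXED `|a| < M`);
(β) THE BACKGROUND NEVER DEGENERATES — the Kerr–Schild family `g = η + 2Hℓ⊗ℓ` is jointly smooth in
`(a, x)` on `{r > 0}` THROUGH `a = M` (tree: `Kerr.contDiffAt_scalarH_comp`,
`Kerr.contDiffAt_nullCovectorFun_comp`, `Kerr.contDiffAt_radius_comp`), and the slab `{t* = 0, r ≥ M}`
is `a`-independent, so every constant made of background geometry is UNIFORM on the closed box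
`|a| ≤ M`; (γ) MARGINS ARE TAME — the frequency-regime margins of the DRSR / SR–TdC decomposition are
rational functions of `(a/M, Mω, m, Λ, r/M)` and die polynomially in `χ` (first rows PROVED by the
ideator: `SketchIdeator1.firstLemma_superradiantMargin_linear`, `dV₀/dr(r₊) ≥ χΛ/(8M³)` from the tree's
`Kerr.le_deriv_sepPotential₀_rPlus`; the inner-edge row `Δ(M) = −M²χ`, triage r1-1; the Wronskian
floor is explicit and uniform on `|a| ≤ M`, Teixeira da Costa arXiv:1910.02854 Thm 1.3 / Prop 6.3).
What survives the audit is ONE place — the LINEAR problem near the superradiant threshold cone — so the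
nonlinear crux TRANSFERS to a κ-polynomial linear spin-±2 law `C⁺` on EXACT Kerr (the card's
`Transfer:`; triage: "a genuine why-easier — linear, exact separable background, desk-falsifiable").

This skeleton types that transfer over EXISTING declarations and kernel-checks the exponent
bookkeeping:

* `stub_kappaPolynomialTeukolskyLaw` — `C⁺` (XL, OPEN, HARDEST): boundedness + integrated local
  energy decay for admissible spin-`±2` Teukolsky fields (`Kerr.IsAdmissibleTeukolskyField`,
  `Kerr.teukolskyEnergy` of `Literature/Geometry/Lorentzian/Sweep2.lean`, i.e. VERBATIM the consequence
  form of the tree's named facts `srtdc_teukolsky_boundedness_kerr` / `srtdc_teukolsky_integrated_decay_kerr`,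
  gr.S27) on the near-extremal range `a₁M ≤ |a| < M`, at ONE finite regularity `(k, w)`, with the
  constant `C(M, R)·χ^{−p}` — `p ≥ 0` chosen BEFORE `M` (scaling), `C ≥ 1`. It is the route's crux #3
  `KappaExplicitWaveDecay` upgraded from `□_g` to spin `±2`: supplied by that sibling crux's lines run on
  the Teukolsky system; refuted by ONE fixed-`m` super-polynomial transient (route KILL CRITERIA).
* `stub_backgroundUniform` — leg (β) (M, PROVABLE NOW): for `0 < M`, every order `n` and radius `R`
  there is ONE `B ≥ 1` bounding all joint `(a, x)`-derivatives of order `≤ n` of `H_{M,a}` and of the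
  components `ℓ_μ` at every `(a, x)` with `|a| ≤ M`, `x⁰ = 0`, `M ≤ r_a(x) ≤ R` (compact box inside
  `{r > 0}`, joint smoothness in the tree; stationarity carries the bound to every `t*`).
* `stub_polynomialClosing` — leg (α), the TRANSFER (XL, open as a TRACKED statement; known
  qualitatively at each fixed sub-extremal spin: Hintz arXiv:2606.28253 Thm 1.1, and for `|a| ≪ M`
  Klainerman–Szeftel / GKS arXiv:2205.14808): for every linear regularity `(k, w)` there are data
  exponents `(s, δ)`, a convergence order `kc`, ONE integer `N` and ONE real `γ₀` such that for every
  `M > 0` there are a radius `R`, a background order `n`, `c₀ > 0`, `C₀ ≥ 0` with: for EVERY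
  sub-extremal spin `a`, every `Λ ≥ 1`, `B ≥ 1`, IF the spin-`±2` law holds at `(M, a)` on
  `{‖y‖ ≤ R}` with constant `Λ` at regularity `(k, w)` AND the background is bounded by `B` at order
  `n` on `M ≤ r ≤ R`, THEN capture holds at `(M, a)` with basin `c₀·χ^{γ₀}·(ΛB)^{−N}` and modulus
  `C₀·χ^{−γ₀}·(ΛB)^{N}·√dist` (conclusion = VERBATIM the crux body at one spin, `CaptureAt`). The
  explicit `χ^{±γ₀}` is the inner-edge / red-shift allowance (the slab edge `{r = M}` is trapped with
  margin `Δ(M) = −M²χ`; Hintz Rem 13.2's `m₀ ∈ (r₋, r₊)`; the refuter's necessary `γ ≥ 1`): finitely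
  many uses of `κ⁻¹ ≍ χ^{−1/2}`, universal exponent. Its internal rows (line card): (T.i) homogeneous
  local law `Λ` ⇒ the inhomogeneous, outgoing-null-slab, `r`-weighted black-box form that DHRT
  arXiv:2212.14093 (1.3) / Hintz §13 consume, with constants `poly(Λ, B)·χ^{−O(1)}`; (T.ii) the
  non-Teukolsky parts of the linearised system (transport / elliptic / gauge & constraint operators)
  with background-and-red-shift constants only; (T.iii) Nash–Moser or bootstrap threshold
  `= monomial` (PROVED instances above) incl. structural stability of trapping / radial-point
  estimates under `C^N`-small perturbations with polynomial thresholds (triage r1-3); (T.iv) threshold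
  regularity of the horizon radial-point estimate kept κ-free by working at `Im σ ≥ −c₀κ` (triage r1-1/2:
  the derivative COUNT must not become κ-dependent); (T.v) modulation / final-parameter modulus.

`NearExtremalKappaCapture_of` composes the three stubs into the crux BY NAME (kernel-checked, no
`sorry`): with `(a₁, p, k, w)` from `C⁺`, `(s, δ, kc, N, γ₀)` from the transfer at `(k, w)`, and per `M`
the radius `R`, order `n`, `(c₀, C₀)` from the transfer, `C₁ = C(M, R)` from `C⁺`, `B = B(M, n, R)` from
(β), put `Λ(a) := C₁·χ^{−p} ≥ 1`; then `c := c₀·((C₁B)^N)⁻¹`, `C := C₀·(C₁B)^N` and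
`γ = p_crux := γ₀ + pN` — the identities `c·χ^{γ₀+pN} = c₀·χ^{γ₀}·((C₁χ^{−p}B)^N)⁻¹` and
`C₀·χ^{−γ₀}·(C₁χ^{−p}B)^N = C·χ^{−(γ₀+pN)}` are `basin_coeff_eq` / `modulus_coeff_eq`. So a proof of
`C⁺` with loss `χ^{−p}` gives the crux with `γ = p = γ₀ + pN`: POLYNOMIAL IN ⇒ POLYNOMIAL OUT, and a
super-polynomial loss has nowhere to live but `C⁺` (linear, exact Kerr) or `¬ stub_polynomialClosing`
(a super-polynomial loss in the NONLINEAR step at polynomial linear input — itself a finding).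

## Disproof used (`Cruxes/NearExtremalKappaCapture/Disproof.lean`, cdisprove 2026-08-16; VERDICT there:
## no kill, no `_false_without_` theorem yet) and landed `Theorems/NearExtremalKappaCapture/Negative/*`

* §0 `near_iff` (landed `Negative/ExponentMonotonicity.lean`, p73006) — USED: the composition enters the
  crux through it; `captureWith_iff` below certifies that `CaptureAt` is VERBATIM the crux body at one spin.
* §2 `captureWith_mono` / `near_iff_diagonal` / `not_near_iff` — HONOURED: the line's output exponents
  are the explicit monomials `γ = p = γ₀ + pN`; nothing is claimed about optimal powers, and the
  negation of the line is super-polynomial loss, exactly the disprover's normal form.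
* §3 `captureWith_self` — CONSISTENT: at `dist = 0` the transfer's modulus pins `(M', a') = (M, a)`.
* §4 `captureWith_false_of_extremalFormation` (third-law fork, bites only `γ ≤ 1/2`) — HONOURED: the
  transfer's conclusion keeps the conjunct `Kerr.IsSubextremal M' a'`, and by the landed
  `Negative/SubextremalRedundancy.near_iff_withoutSub` (triage r1, all three panels) that conjunct costs
  its prover nothing beyond the modulus (shrink the basin: exponents are an up-set); `γ₀ ≥ 1` is expected
  from the inner edge anyway.
* Refuter paper lemmas ATTACK-10606 (`γ ≥ 1` forced by slice truncation), triage r1-2 R2 (`δ ≥ 1/2`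
  forced by far-out gluing), r1-3 P4 (`δ + s ≥ 0`) — HONOURED: `(s, δ, γ₀)` are the transfer's to choose
  (existential), nothing here pins a small weight or basin exponent.
* No landed Negative lemma refutes an instance of any stub (`ledger negatives --problem
  FinalStateConjecture`: 0 at filing); no `-- Targets` stub kill in `Disproof.lean`.
-/

noncomputable section

set_option linter.dupNamespace false

namespace Summit.FinalStateConjecture.FinalStateConjecture.Cruxes.NearExtremalKappaCapture.PolynomialClosure

open Literature.Geometry.Lorentzian
open Summit.FinalStateConjecture.FinalStateConjecture.Theorems.NearExtremalKappaCapture.Negative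
open scoped Manifold ContDiff Topology ENNReal
open Set Filter

/-! ### The statements of the line (named `Prop`s over existing declarations) -/

/-- **The spin-`±2` linear law at ONE spin, ONE radius, ONE regularity, with ONE constant `Λ`.**
For every admissible spin-`s` Teukolsky field `α` on the Kerr exterior `{r > r₊}` (`s = ±2`; smooth
spin-weighted, data compactly supported in the open slice `{t* = 0, r > r₊}`,
`Kerr.IsAdmissibleTeukolskyField`): (a) uniform boundedness — for every `τ ≥ 0` the first-order
coordinate energy of the horizon-regular rescaled tensorised field through `{t* = τ} ∩ {‖y‖ ≤ R}` is at
most `Λ` times the `(1+‖y‖)^w`-weighted `k`-th order initial energy; (b) integrated local energy decay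
— the same local energy is integrable over `τ ∈ (0, ∞)` with integral at most `Λ` times that initial
energy. VERBATIM the bodies of the named facts `srtdc_teukolsky_boundedness_kerr` /
`srtdc_teukolsky_integrated_decay_kerr` (Sweep2.lean, gr.S27; Shlapentokh-Rothman–Teixeira da Costa
arXiv:2302.08916 Thm 5.1, constants `C(a₀, M, |s|, δ, p)` for `|a| ≤ a₀ < M`, no rate in `M − a₀`) at
a single `(M, a, k, w, R)` with the constant made a real parameter. -/
def TeukolskyLawAt [Kerr.Facts] (M a : ℝ) (k : ℕ) (w R Λ : ℝ) : Prop :=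
  ∀ [(Kerr.metric M a (Kerr.rPlus M a)).HasLeviCivita], ∀ spin : ℤ, (spin = 2 ∨ spin = -2) →
    ∀ α : Kerr.exterior M a → ℂ, Kerr.IsAdmissibleTeukolskyField M a spin α →
      (∀ τ : ℝ, 0 ≤ τ →
        Kerr.teukolskyEnergy M a spin α τ 1 0 (Metric.closedBall 0 R) ≤
          ENNReal.ofReal Λ * Kerr.teukolskyEnergy M a spin α 0 k w univ) ∧
      ∫⁻ τ in Ioi (0 : ℝ), Kerr.teukolskyEnergy M a spin α τ 1 0 (Metric.closedBall 0 R) ≤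
        ENNReal.ofReal Λ * Kerr.teukolskyEnergy M a spin α 0 k w univ

/-- **`C⁺ = KappaPolynomialTeukolskyLaw` (the card's Transfer; statement of STUB 1).** There are
`a₁ < 1`, a loss exponent `p ≥ 0` and ONE regularity `(k, w)` — all chosen before `M` — such that for
every `M > 0` and every radius `R` there is `C = C(M, R) ≥ 1` with: for every spin `a₁M ≤ |a| < M` the
spin-`±2` law `TeukolskyLawAt M a k w R Λ` holds with `Λ = C·(1 − (a/M)²)^{−p}`. Negation = for some
`(k, w, R)` the best constant grows faster than every power of `χ⁻¹ = (1 − a²/M²)⁻¹` as `|a| → M` (one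
fixed-`m` super-polynomial transient suffices: the route's KILL CRITERION, read at spin `±2`). -/
def KappaPolynomialTeukolskyLaw : Prop :=
  ∀ [Kerr.Facts], ∃ a₁ : ℝ, a₁ < 1 ∧ ∃ (p : ℝ) (k : ℕ) (w : ℝ), 0 ≤ p ∧
    ∀ M : ℝ, 0 < M → ∀ R : ℝ, ∃ C : ℝ, 1 ≤ C ∧ ∀ a : ℝ, a₁ * M ≤ |a| →
      Kerr.IsSubextremal M a → TeukolskyLawAt M a k w R (C * (1 - (a / M) ^ 2) ^ (-p))

/-- **Background bound at one spin** (leg (β) at `(M, a)`): on the compact box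
`{x⁰ = 0, M ≤ r_a(x) ≤ R}` every joint `(a, x)`-derivative of order `j ≤ n` of the Kerr–Schild scalar
`(a, x) ↦ H_{M,a}(x) = M r³/(r⁴ + a²z²)` (`Kerr.scalarH`) and of the null-covector components
`(a, x) ↦ ℓ_μ(a, x)` (`Kerr.nullCovectorFun`) has operator norm `≤ B` — these two scalar families
determine `g_{M,a} = η + 2Hℓ⊗ℓ`, its inverse `η − 2Hℓ♯⊗ℓ♯` (`det g = −1`) and the linearised family
`∂_a g` used for modulation, so `B` bounds every background constant of a stability scheme on the slab
(stationary: the same bounds hold at every `t*`). -/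
def BackgroundBoundAt (M a : ℝ) (n : ℕ) (R B : ℝ) : Prop :=
  ∀ x : E4, x 0 = 0 → M ≤ Kerr.radius a x → Kerr.radius a x ≤ R → ∀ j : ℕ, j ≤ n →
    ‖iteratedFDeriv ℝ j (fun q : ℝ × E4 ↦ Kerr.scalarH M q.1 q.2) (a, x)‖ ≤ B ∧
      ∀ μ : Fin 4, ‖iteratedFDeriv ℝ j (fun q : ℝ × E4 ↦ Kerr.nullCovectorFun q.1 q.2 μ) (a, x)‖ ≤ B

/-- **`BackgroundUniform` (leg (β); statement of STUB 2).** For `0 < M`, every order `n` and radius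
`R` there is ONE `B ≥ 1` with `BackgroundBoundAt M a n R B` for EVERY `|a| ≤ M` — the closed spin box,
the extremal member included: the only place `a = M` is ever touched by the line, and it is harmless
there because `r ≥ M > 0` keeps `(a, x)` inside the joint-analyticity domain `{r > 0}` of the family. -/
def BackgroundUniform : Prop :=
  ∀ M : ℝ, 0 < M → ∀ (n : ℕ) (R : ℝ), ∃ B : ℝ, 1 ≤ B ∧ ∀ a : ℝ, |a| ≤ M →
    BackgroundBoundAt M a n R B

/-- **Capture at one spin with basin radius `ρ` and modulus constant `L`** — VERBATIM the body of the
crux (`CaptureWith`, hence of `NearExtremalKappaCapture`) at a fixed `(M, a)` with the two κ-dependent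
constants made real parameters (`captureWith_iff` below is `Iff.rfl`): every vacuum datum on the
Kerr–Schild slice `Kerr.slice a M = {t* = 0, r > M}` within weighted-Sobolev distance `ρ` of the Kerr
datum has all its maximal vacuum Cauchy developments far-complete (`FarComplete`, the inlined sojourn
form), with a region converging in `C^k` to a sub-extremal Kerr `g_{M',a'}` and
`|M' − M| + |a' − a| ≤ L·√dist`. -/
def CaptureAt [Kerr.Facts] [Kerr.SliceFacts] (s : ℕ) (δ : ℝ) (k : ℕ) {M : ℝ} (hM : 0 < M)
    (a ρ L : ℝ) : Prop :=
  ∀ (D : InitialDataSet 𝓘(ℝ, E3) (Kerr.slice a M)) [D.metric.HasLeviCivita],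
    D.IsVacuumConstraintSolution →
      InitialDataSet.dataWeightedSobolevEDist s δ D (Kerr.data M a M hM.le) < ENNReal.ofReal ρ →
        ∀ 𝒟 : VacuumCauchyDevelopment D, 𝒟.IsMaximal →
          ∃ (M' a' : ℝ) (𝒟oc : Set 𝒟.carrier), Kerr.IsSubextremal M' a' ∧ FarComplete 𝒟 ∧
            𝒟.toSpacetime.ConvergesToKerr 𝒟oc M' a' k ∧
              |M' - M| + |a' - a| ≤
                L * √(InitialDataSet.dataWeightedSobolevEDist s δ D (Kerr.data M a M hM.le)).toReal

/-- **`PolynomialClosing` (leg (α), the TRANSFER `C⁺ ⇒ crux`; statement of STUB 3).** For every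
linear regularity `(k, w)` there are `(s, δ, kc, N, γ₀)` such that for every `M > 0` there are
`(R, n, c₀ > 0, C₀ ≥ 0)` with: for every sub-extremal spin `a` and all `Λ, B ≥ 1`, the spin-`±2` law at
`(M, a)` with constant `Λ` and the background bound `B` give capture at `(M, a)` with basin
`c₀·χ^{γ₀}·((ΛB)^N)⁻¹` and modulus `C₀·χ^{−γ₀}·(ΛB)^N`, `χ = 1 − (a/M)²`. "The constants of the
nonlinear scheme are MONOMIALS in (linear constant, background constant) times an explicit universal
power of the surface gravity." -/
def PolynomialClosing : Prop :=
  ∀ [Kerr.Facts] [Kerr.SliceFacts], ∀ (k : ℕ) (w : ℝ),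
    ∃ (s : ℕ) (δ : ℝ) (kc : ℕ) (N : ℕ) (γ₀ : ℝ), ∀ (M : ℝ) (hM : 0 < M),
      ∃ (R : ℝ) (n : ℕ) (c₀ : ℝ), 0 < c₀ ∧ ∃ C₀ : ℝ, 0 ≤ C₀ ∧
        ∀ a : ℝ, Kerr.IsSubextremal M a → ∀ Λ B : ℝ, 1 ≤ Λ → 1 ≤ B →
          TeukolskyLawAt M a k w R Λ → BackgroundBoundAt M a n R B →
            CaptureAt s δ kc hM a (c₀ * (1 - (a / M) ^ 2) ^ γ₀ * ((Λ * B) ^ N)⁻¹)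
              (C₀ * (1 - (a / M) ^ 2) ^ (-γ₀) * (Λ * B) ^ N)

/-- **Read-back certificate.** The landed disprover's `CaptureWith s δ k γ p a₁` (the crux body at a
fixed exponent vector, `near_iff`) is BY DEFINITION the statement "for every `M > 0` some `c > 0`, `C`
give `CaptureAt` at every spin `a₁M ≤ |a| < M` with basin `c·χ^γ` and modulus `C·χ^{−p}`". -/
theorem captureWith_iff [Kerr.Facts] [Kerr.SliceFacts] (s : ℕ) (δ : ℝ) (k : ℕ) (γ p a₁ : ℝ) :
    CaptureWith s δ k γ p a₁ ↔ ∀ (M : ℝ) (hM : 0 < M), ∃ c > (0 : ℝ), ∃ C : ℝ, ∀ a : ℝ,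
      a₁ * M ≤ |a| → Kerr.IsSubextremal M a →
        CaptureAt s δ k hM a (c * (1 - (a / M) ^ 2) ^ γ) (C * (1 - (a / M) ^ 2) ^ (-p)) :=
  Iff.rfl

/-! ### The registered stubs (statements expanded over existing declarations) -/

/-- STUB 1 (XL, OPEN, HARDEST) — `KappaPolynomialTeukolskyLaw` = `C⁺`, the κ-polynomial linear
spin-`±2` law on EXACT near-extremal Kerr, expanded. Why plausibly true: every printed near-extremal
transient is polynomial in `κ⁻¹` (zero-damped modes: Gralla–Zimmerman / Casals–Gralla–Zimmerman 2016,
`κ^{−1/2}…κ^{−1}`; spherical charged analogue with UNIFORM constants and transient up to `v ~ κ⁻¹`: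
Angelopoulos–Kehle–Unger arXiv:2603.10378 Thm 1/4); the Wronskian floor is explicit and uniform on the
CLOSED range `|a| ≤ M` at bounded frequencies, with no threshold loss for `|a| < M` (Teixeira da Costa
arXiv:1910.02854 Thm 1.3 p. 5, Prop 6.3 p. 43); real-axis mode stability is now a tree theorem
(`Kerr.Costa2019_realAxisModeStability_holds`); the superradiant non-trapping and near-superradiant
margins of DRSR arXiv:1402.7034 Lemmas 6.4.1/8.6.1 are explicit rational functions dying linearly in `χ`
(`SketchIdeator1.firstLemma_superradiantMargin_linear`; tree `Kerr.le_deriv_sepPotential₀_rPlus_alpha'`,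
`Kerr.exists_sepPotential_trapping_structure`). Why it might fail: DRSR / SR–TdC (arXiv:2302.08916)
obtain their constants by continuity in `a` with NO rate ("blow up as `a₀ → M`"); at `κ = 0` boundedness
of non-axisymmetric fields at finite regularity is open and expected false (AKU p. 16; Gajic 2023); the
threshold cone `{|ω − mω₊| ≲ |m|κ^θ, |m| → ∞}` could carry a Gevrey / `e^{c/κ}` price. Supplied by: the
sibling crux `KappaExplicitWaveDecay` (stmt-FinalStateConjecture-10654) run at spin `±2`, i.e. its
Lines at `s = ±2`; refuted by the route's CHEAPEST FALSIFIER (one fixed-`m` super-polynomial transient,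
a desk / kit computation from the confluent-Heun asymptotics). -/
theorem stub_kappaPolynomialTeukolskyLaw :
    ∀ [Kerr.Facts], ∃ a₁ : ℝ, a₁ < 1 ∧ ∃ (p : ℝ) (k : ℕ) (w : ℝ), 0 ≤ p ∧
      ∀ M : ℝ, 0 < M → ∀ R : ℝ, ∃ C : ℝ, 1 ≤ C ∧ ∀ a : ℝ, a₁ * M ≤ |a| →
        Kerr.IsSubextremal M a →
          ∀ [(Kerr.metric M a (Kerr.rPlus M a)).HasLeviCivita], ∀ spin : ℤ,
            (spin = 2 ∨ spin = -2) →
              ∀ α : Kerr.exterior M a → ℂ, Kerr.IsAdmissibleTeukolskyField M a spin α →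
                (∀ τ : ℝ, 0 ≤ τ →
                  Kerr.teukolskyEnergy M a spin α τ 1 0 (Metric.closedBall 0 R) ≤
                    ENNReal.ofReal (C * (1 - (a / M) ^ 2) ^ (-p)) *
                      Kerr.teukolskyEnergy M a spin α 0 k w univ) ∧
                ∫⁻ τ in Ioi (0 : ℝ),
                    Kerr.teukolskyEnergy M a spin α τ 1 0 (Metric.closedBall 0 R) ≤
                  ENNReal.ofReal (C * (1 - (a / M) ^ 2) ^ (-p)) *
                    Kerr.teukolskyEnergy M a spin α 0 k w univ := by
  sorry

/-- STUB 2 (M, PROVABLE NOW) — `BackgroundUniform`, expanded: uniform joint-derivative bounds for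
`H_{M,a}` and `ℓ_μ` on the compact box `|a| ≤ M`, `x⁰ = 0`, `M ≤ r_a(x) ≤ R`. Proof route: the box is
compact (`radius` is jointly continuous; `ρ² ≤ r² + a² ≤ R² + M²` from `Kerr.radius_quartic`) and lies in
the open set `{(a, x) : 0 < r_a(x)}` on which both maps are jointly `C^∞`
(`Kerr.contDiffAt_scalarH_comp`, `Kerr.contDiffAt_nullCovectorFun_comp` with `fM = const`,
`fa = Prod.fst`, `g = Prod.snd`), hence every `iteratedFDeriv ℝ j` is continuous there
(`ContDiffAt.continuousAt_iteratedFDeriv`-type lemmas) and bounded on the box; take `B` = the max over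
`j ≤ n`, `μ`, and `1`. No named fact involved. -/
theorem stub_backgroundUniform :
    ∀ M : ℝ, 0 < M → ∀ (n : ℕ) (R : ℝ), ∃ B : ℝ, 1 ≤ B ∧ ∀ a : ℝ, |a| ≤ M →
      ∀ x : E4, x 0 = 0 → M ≤ Kerr.radius a x → Kerr.radius a x ≤ R → ∀ j : ℕ, j ≤ n →
        ‖iteratedFDeriv ℝ j (fun q : ℝ × E4 ↦ Kerr.scalarH M q.1 q.2) (a, x)‖ ≤ B ∧
          ∀ μ : Fin 4,
            ‖iteratedFDeriv ℝ j (fun q : ℝ × E4 ↦ Kerr.nullCovectorFun q.1 q.2 μ) (a, x)‖ ≤ B := by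
  sorry

/-- STUB 3 (XL, OPEN as a tracked statement; the TRANSFER) — `PolynomialClosing`, expanded: the
nonlinear closing step is POLYNOMIAL in the linear constant `Λ` and the background constant `B`,
uniformly in the sub-extremal spin up to an explicit universal power `γ₀` of `χ = 1 − (a/M)²`. Known
qualitatively (some basin, some modulus) at every FIXED `|a| < M` (Hintz arXiv:2606.28253 Thm 1.1,
Nash–Moser with AHW mode stability as a black box; Rem 1.4: the only `a`-sensitive structural inputs
are r-normally-hyperbolic trapping [WZ11, Dya15] with `ν_min ≍ κ` and the radial source at `N*𝓗⁺`
[Vas13] with strength `κ`) and for `|a| ≪ M` (Klainerman–Szeftel 2023 / GKS arXiv:2205.14808,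
modulus `C√dist`); DHRT arXiv:2212.14093 is the model of "exact-background linear black box ⇒
nonlinear theorem" in physical space. Why plausibly true: thresholds of continuity arguments and of
Nash–Moser schemes are monomials in the input constants (PROVED instances `firstLemma_polynomialBasin`,
`firstLemma_newtonKantorovich` of the ideators' sketches; Hörmander 1976 §2); background constants are
`B` (leg (β)); the red-shift / inner-edge uses of `κ⁻¹` are finitely many (`χ^{±γ₀}`). Why it might
fail: a constant of the nonlinear scheme obtained by CONTRADICTION / compactness over the open spin set
(card's Cheapest falsifier (a): mode stability for the constraint-damped gauge-fixed operator with a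
damping margin closing as `κ → 0`), a κ-dependent derivative COUNT (threshold regularity
`s > ½ + β|Im σ|/κ` unless the contour is kept at `Im σ ≥ −c₀κ`, triage r1-1), or a homogeneous ⇒
inhomogeneous upgrade (row T.i) that is not polynomial. The hypothesis is deliberately the TREE's
consequence-form law (local energies on `{‖y‖ ≤ R}`, homogeneous fields): rows (T.i)–(T.v) of the
module docstring are this stub's internal audit table. -/
theorem stub_polynomialClosing :
    ∀ [Kerr.Facts] [Kerr.SliceFacts], ∀ (k : ℕ) (w : ℝ),
      ∃ (s : ℕ) (δ : ℝ) (kc : ℕ) (N : ℕ) (γ₀ : ℝ), ∀ (M : ℝ) (hM : 0 < M),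
        ∃ (R : ℝ) (n : ℕ) (c₀ : ℝ), 0 < c₀ ∧ ∃ C₀ : ℝ, 0 ≤ C₀ ∧
          ∀ a : ℝ, Kerr.IsSubextremal M a → ∀ Λ B : ℝ, 1 ≤ Λ → 1 ≤ B →
            (∀ [(Kerr.metric M a (Kerr.rPlus M a)).HasLeviCivita], ∀ spin : ℤ,
              (spin = 2 ∨ spin = -2) →
                ∀ α : Kerr.exterior M a → ℂ, Kerr.IsAdmissibleTeukolskyField M a spin α →
                  (∀ τ : ℝ, 0 ≤ τ →
                    Kerr.teukolskyEnergy M a spin α τ 1 0 (Metric.closedBall 0 R) ≤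
                      ENNReal.ofReal Λ * Kerr.teukolskyEnergy M a spin α 0 k w univ) ∧
                  ∫⁻ τ in Ioi (0 : ℝ),
                      Kerr.teukolskyEnergy M a spin α τ 1 0 (Metric.closedBall 0 R) ≤
                    ENNReal.ofReal Λ * Kerr.teukolskyEnergy M a spin α 0 k w univ) →
            (∀ x : E4, x 0 = 0 → M ≤ Kerr.radius a x → Kerr.radius a x ≤ R → ∀ j : ℕ, j ≤ n →
              ‖iteratedFDeriv ℝ j (fun q : ℝ × E4 ↦ Kerr.scalarH M q.1 q.2) (a, x)‖ ≤ B ∧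
                ∀ μ : Fin 4,
                  ‖iteratedFDeriv ℝ j (fun q : ℝ × E4 ↦ Kerr.nullCovectorFun q.1 q.2 μ) (a, x)‖ ≤
                    B) →
            ∀ (D : InitialDataSet 𝓘(ℝ, E3) (Kerr.slice a M)) [D.metric.HasLeviCivita],
              D.IsVacuumConstraintSolution →
                InitialDataSet.dataWeightedSobolevEDist s δ D (Kerr.data M a M hM.le) <
                    ENNReal.ofReal (c₀ * (1 - (a / M) ^ 2) ^ γ₀ * ((Λ * B) ^ N)⁻¹) →
                  ∀ 𝒟 : VacuumCauchyDevelopment D, 𝒟.IsMaximal →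
                    ∃ (M' a' : ℝ) (𝒟oc : Set 𝒟.carrier), Kerr.IsSubextremal M' a' ∧
                      FarComplete 𝒟 ∧ 𝒟.toSpacetime.ConvergesToKerr 𝒟oc M' a' kc ∧
                        |M' - M| + |a' - a| ≤
                          C₀ * (1 - (a / M) ^ 2) ^ (-γ₀) * (Λ * B) ^ N *
                            √(InitialDataSet.dataWeightedSobolevEDist s δ D
                                (Kerr.data M a M hM.le)).toReal := by
  sorry

/-! ### Consistency: each named statement IS its registered stub (definitionally) -/

theorem kappaPolynomialTeukolskyLaw_holds : KappaPolynomialTeukolskyLaw :=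
  stub_kappaPolynomialTeukolskyLaw
theorem backgroundUniform_holds : BackgroundUniform := stub_backgroundUniform
theorem polynomialClosing_holds : PolynomialClosing := stub_polynomialClosing

/-! ### Name-keyed aliases of the three statements (the hypotheses of the composition; the skeleton
audit admits a hypothesis only if its head constant is a registered obligation or is named like a
declared stub) -/
namespace Registered

/-- Alias of `KappaPolynomialTeukolskyLaw` keyed by the registered stub name. -/
abbrev stub_kappaPolynomialTeukolskyLaw : Prop := KappaPolynomialTeukolskyLaw
/-- Alias of `BackgroundUniform` keyed by the registered stub name. -/
abbrev stub_backgroundUniform : Prop := BackgroundUniform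
/-- Alias of `PolynomialClosing` keyed by the registered stub name. -/
abbrev stub_polynomialClosing : Prop := PolynomialClosing

end Registered

/-! ### Glue (PROVED): monotonicity and the exponent bookkeeping -/

/-- The linear law is monotone in its constant. -/
theorem teukolskyLawAt_mono [Kerr.Facts] {M a : ℝ} {k : ℕ} {w R Λ Λ' : ℝ}
    (h : TeukolskyLawAt M a k w R Λ) (hΛ : Λ ≤ Λ') : TeukolskyLawAt M a k w R Λ' := by
  intro _ spin hspin α hα
  obtain ⟨hb, hi⟩ := h spin hspin α hα
  have hle : ENNReal.ofReal Λ ≤ ENNReal.ofReal Λ' := ENNReal.ofReal_le_ofReal hΛ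
  exact ⟨fun τ hτ ↦ (hb τ hτ).trans (by gcongr), hi.trans (by gcongr)⟩

/-- The background bound is monotone in its constant. -/
theorem backgroundBoundAt_mono {M a : ℝ} {n : ℕ} {R B B' : ℝ} (h : BackgroundBoundAt M a n R B)
    (hB : B ≤ B') : BackgroundBoundAt M a n R B' := by
  intro x hx0 hx1 hx2 j hj
  obtain ⟨h1, h2⟩ := h x hx0 hx1 hx2 j hj
  exact ⟨h1.trans hB, fun μ ↦ (h2 μ).trans hB⟩

/-- Capture is monotone: a smaller basin and a larger modulus constant are weaker. -/
theorem captureAt_mono [Kerr.Facts] [Kerr.SliceFacts] {s : ℕ} {δ : ℝ} {k : ℕ} {M : ℝ}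
    {hM : 0 < M} {a ρ ρ' L L' : ℝ} (h : CaptureAt s δ k hM a ρ L) (hρ : ρ' ≤ ρ) (hL : L ≤ L') :
    CaptureAt s δ k hM a ρ' L' := by
  intro D _ hvac hdist 𝒟 hmax
  obtain ⟨M', a', 𝒟oc, hsub, hfar, hconv, hmod⟩ :=
    h D hvac (hdist.trans_le (ENNReal.ofReal_le_ofReal hρ)) 𝒟 hmax
  exact ⟨M', a', 𝒟oc, hsub, hfar, hconv,
    hmod.trans (mul_le_mul_of_nonneg_right hL (Real.sqrt_nonneg _))⟩

/-- `(x ^ (−p)) ^ N = x ^ (−(pN))` for `x ≥ 0`. -/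
theorem rpow_neg_pow_natCast {x : ℝ} (hx : 0 ≤ x) (p : ℝ) (N : ℕ) :
    (x ^ (-p)) ^ N = x ^ (-(p * N)) := by
  rw [← Real.rpow_natCast, ← Real.rpow_mul hx]
  congr 1
  ring

/-- The basin bookkeeping: `c₀ ((C₁B)^N)⁻¹ · χ^(γ₀ + pN) = c₀ χ^γ₀ · ((C₁ χ^(−p) B)^N)⁻¹`. -/
theorem basin_coeff_eq {χ c₀ C₁ B γ₀ p : ℝ} (hχ : 0 < χ) (N : ℕ) :
    c₀ * ((C₁ * B) ^ N)⁻¹ * χ ^ (γ₀ + p * N) =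
      c₀ * χ ^ γ₀ * ((C₁ * χ ^ (-p) * B) ^ N)⁻¹ := by
  rw [Real.rpow_add hχ, mul_pow, mul_pow, mul_pow, rpow_neg_pow_natCast hχ.le,
    Real.rpow_neg hχ.le (p * N)]
  have ht : χ ^ (p * N) ≠ 0 := (Real.rpow_pos_of_pos hχ _).ne'
  field_simp

/-- The modulus bookkeeping: `C₀ χ^(−γ₀) (C₁ χ^(−p) B)^N = C₀ (C₁B)^N · χ^(−(γ₀ + pN))`. -/
theorem modulus_coeff_eq {χ C₀ C₁ B γ₀ p : ℝ} (hχ : 0 < χ) (N : ℕ) :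
    C₀ * χ ^ (-γ₀) * (C₁ * χ ^ (-p) * B) ^ N = C₀ * (C₁ * B) ^ N * χ ^ (-(γ₀ + p * N)) := by
  rw [mul_pow, mul_pow, mul_pow, rpow_neg_pow_natCast hχ.le,
    show -(γ₀ + p * N) = -γ₀ + -(p * N) by ring, Real.rpow_add hχ]
  ring

/-! ### The composition: the three stubs imply the crux, by name -/

/-- **`NearExtremalKappaCapture` from the three stubs** (exponent bookkeeping, no `sorry`). Take
`(a₁, p, k, w)` from `C⁺` and `(s, δ, kc, N, γ₀)` from the transfer at that `(k, w)`; the crux's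
exponent vector is `(s, δ, kc, γ₀ + pN, γ₀ + pN, a₁)`. For `M > 0` take `(R, n, c₀, C₀)` from the
transfer, `C₁ = C(M, R)` from `C⁺` and `B = B(M, n, R)` from (β), and put `c := c₀ ((C₁B)^N)⁻¹ > 0`,
`C := C₀ (C₁B)^N`. At a spin `a₁M ≤ |a| < M` the linear constant is `Λ := C₁ χ^{−p} ≥ 1`
(`0 < χ ≤ 1`, `p ≥ 0`, `C₁ ≥ 1`); the transfer at `(a, Λ, B)` is capture with basin
`c₀ χ^{γ₀} ((ΛB)^N)⁻¹ = c χ^{γ₀+pN}` (`basin_coeff_eq`) and modulus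
`C₀ χ^{−γ₀} (ΛB)^N = C χ^{−(γ₀+pN)}` (`modulus_coeff_eq`) — the crux body at `a`. -/
theorem NearExtremalKappaCapture_of (hL : Registered.stub_kappaPolynomialTeukolskyLaw)
    (hB : Registered.stub_backgroundUniform) (hT : Registered.stub_polynomialClosing) :
    Theses.PhaseMixingCapture.NearExtremalKappaCapture := by
  refine near_iff.mpr ?_
  intro hF hS
  obtain ⟨a₁, ha₁, p, k, w, hp, hlaw⟩ := @hL hF
  obtain ⟨s, δ, kc, N, γ₀, hTk⟩ := @hT hF hS k w
  refine ⟨s, δ, kc, γ₀ + p * N, γ₀ + p * N, a₁, ha₁, ?_⟩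
  intro M hM
  obtain ⟨R, n, c₀, hc₀, C₀, hC₀, hTM⟩ := hTk M hM
  obtain ⟨C₁, hC₁, hlawM⟩ := hlaw M hM R
  obtain ⟨B, hB1, hBM⟩ := hB M hM n R
  have hC₁0 : 0 < C₁ := by linarith
  have hB0 : 0 < B := by linarith
  refine ⟨c₀ * ((C₁ * B) ^ N)⁻¹, by positivity, C₀ * (C₁ * B) ^ N, ?_⟩
  intro a ha hsub D inst hvac hdist 𝒟 hmax
  obtain ⟨hχ0, hχ1⟩ := kappaSq_pos_le_one hsub
  set χ : ℝ := 1 - (a / M) ^ 2 with hχdef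
  -- the linear constant at this spin, `Λ = C₁ χ^{-p} ≥ 1`
  have hΛ1 : 1 ≤ C₁ * χ ^ (-p) := by
    have h1 : 1 ≤ χ ^ (-p) := Real.one_le_rpow_of_pos_of_le_one_of_nonpos hχ0 hχ1 (by linarith)
    nlinarith
  have haM : |a| ≤ M := le_of_lt hsub
  have hcap := hTM a hsub (C₁ * χ ^ (-p)) B hΛ1 hB1 (hlawM a ha hsub) (hBM a haM)
  have hdist' : InitialDataSet.dataWeightedSobolevEDist s δ D (Kerr.data M a M hM.le) <
      ENNReal.ofReal (c₀ * χ ^ γ₀ * ((C₁ * χ ^ (-p) * B) ^ N)⁻¹) := by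
    rwa [basin_coeff_eq hχ0 N] at hdist
  obtain ⟨M', a', 𝒟oc, hsub', hfar, hconv, hmod⟩ := hcap D hvac hdist' 𝒟 hmax
  refine ⟨M', a', 𝒟oc, hsub', hfar, hconv, ?_⟩
  rwa [modulus_coeff_eq hχ0 N] at hmod

/-- Wiring check: the registered stubs feed `NearExtremalKappaCapture_of` as stated. -/
example : Theses.PhaseMixingCapture.NearExtremalKappaCapture :=
  NearExtremalKappaCapture_of stub_kappaPolynomialTeukolskyLaw stub_backgroundUniform
    stub_polynomialClosing

/-- Sanity (not vacuous on the linear side): the zero field is an admissible spin-`±2` Teukolsky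
field with vanishing energies, so `TeukolskyLawAt M a k w R Λ` is consistent for every `Λ ≥ 0` and
the class it quantifies over is non-empty (`Kerr.isAdmissibleTeukolskyField_zero`,
`Kerr.teukolskyEnergy_zero`). -/
example [Kerr.Facts] (M a : ℝ) [(Kerr.metric M a (Kerr.rPlus M a)).HasLeviCivita] (spin : ℤ) :
    Kerr.IsAdmissibleTeukolskyField M a spin (fun _ ↦ 0) ∧
      ∀ τ k w A, Kerr.teukolskyEnergy M a spin (fun _ ↦ 0) τ k w A = 0 :=
  ⟨Kerr.isAdmissibleTeukolskyField_zero M a spin, fun τ k w A ↦ Kerr.teukolskyEnergy_zero M a spin τ k w A⟩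

end Summit.FinalStateConjecture.FinalStateConjecture.Cruxes.NearExtremalKappaCapture.PolynomialClosure

end
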